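import Literature.NumberTheory.LFunctions.Zhang2022.DetectorEntangledCone
import Literature.NumberTheory.LFunctions.Zhang2022.RepairRplus

/-!
# Zhang (2022), F-S3 programme §E (cell landau-siegel): the §E family of ENTANGLED class-DET detectors
# (widened clause (i′) of KILL(B-det)) — verdict «no POS closing at main order» with the E-102 member displayed

Y. Zhang, *Discrete mean estimates and the Landau–Siegel zero*, arXiv:2211.02515v1 [Zhang2022LandauSiegel] —
an unrefereed manuscript under adjudication. **WHAT THIS IS NOT: not a claim about Theorems 1–2 of
arXiv:2211.02515, about Landau–Siegel zeros, or about Parity; nothing here asserts any claim of the manuscript,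
and nothing here asserts the registry row E-102 (det-E15 «E-det-cone») or any of its members — the member is
DISPLAYED as the hypothesis of the verdict (kind (c)), never placed in the class and never decided here.**
«The programme SEARCHES and TYPES; KILL(B-det) says the det design space as scanned contains no repair of the
§18 margin, GIVEN E-102; no claim about Landau–Siegel zeros, Theorems 1–2 of arXiv:2211.02515 or a repaired
Margin232 follows.»

A SLICE file for the §E intake of the word KILL(B-det) (director-frontier, of record 2026-08-26T23:09:45Z with the
§1a clause RE-SAID 2026-08-26T23:27:01Z: «KILL(B-det) INSIDE DET: decided on the scanned generators (sign-admissible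
monomials; SOS rank-one slices; two-profile entangled pairs — certified two-lineage); full 19-palette BigF: NO
CERTIFIED NEGATIVE DIRECTION (two-lineage; λ_min enclosure ⊂ [−1.03e-8, 1.8e-10] at N = 12, B′ / A-v2), PSD NOT
CERTIFIED, kernel nature OPEN (B′ j262052 in flight); GIVEN det-E15 E-det-cone (E-102) on the continuum.» —
provisional on the referee's countersign (w1″) at the time of typing; certificate `B-det/KILL-draft.md` v1.8
a515c90d58d0257f, frozen as v2.0 547cbfcd828e180c; class text §2 (i′) = REF-B1 R-d2p-2 «cubic forms in any finite
number of shifted M-values»). STATUS FLAGS of this row: **CONDITIONAL — GIVEN E-102 (the member `Det.ConePSD a b` is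
DISPLAYED in the verdict, never placed in the class, never decided here); coverage counted once (the `K = 1` members
coincide with repeated-shift monomials, the SOS cells with det-D2⁺ rows — the stronger currency wins, no double count);
nothing in this file says or implies that any block matrix is PSD.** It supplies ONE `Repair.DesignFamily` in the
extension protocol of `RepairRplus` (`Design` / `InClass` / `Verdict`, every conditional input displayed inside `Verdict`):

* `Repair.DetEntangledDesign` — an entangled detector of class DET as §E data: `K` palette shifts `b_j ∈ (0,5)`,
  an anchor `a ∈ (0,1)`, and the profile vector `h` (marked derivatives `h′`) the design is run on; its (A)-main
  term under the cell's derivation is the block form `Det.entangledMain a b h h′ = hᵀ·BigF(a;b)·h`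
  (file `DetectorEntangledCone`, p473997) — design data, the derivation (E-010(i), repeated-shift rule, E-080)
  is not asserted.
* `InClass` — NO analytic hypothesis: `0 < a < 1`, `0 < b_j < 5`, each `h_j` a one-sided kinked profile with
  `h_j(1) = 0` (the range (7.2) of Prop 7.1).
* `Verdict d := Det.ConePSD d.a d.b → ¬ (Re m(a;b;h) < 0)`: GIVEN the E-102 MEMBER at `(a,b)` («`BigF(a;b) ⪰ 0`
  on one-sided kinked profiles», `Det.ConePSD`, bare `Prop`), the POS endgame of the entangled detector — a
  pointwise non-negative statistic (`Det.entangledStat_re_nonneg`) whose main-term constant would have to be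
  NEGATIVE to close (`Det.not_tendsto_of_neg`) — does not close at main order. Decided by one line
  (`not_repairable_detEntangled`); CS/Gram-type endgames between entangled statistics are principal-sub-block
  statements of the same matrices (REF-B1 R-d2p-3) and are not separate rows.
* `familyDetEntangled`, `familyDetEntangled_decided`, `rplus_detEntangled_decided` (`R⁺ ++ [familyDetEntangled]`
  decided) — the row the assembly `Repair.Rplusplus⟨k⟩` and the intake `Repair.bdetWord2` cite; GIVEN the ROW
  `Det.EdetCone (Set.Ioo 0 1) (Set.Ioo 0 5)` every member's slot is discharged (`detEntangled_nonneg_of_edetCone`).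
* C2 (agreement on common members): the `K = 1` members are the repeated-shift monomials `X_a·X_x²`, whose
  verdict reads through `Det.FormDetDD (a,x,x)` (`detEntangled_verdict_fin_one`); C4 (members by term): the
  det-D2⁺ SOS cells `sosCell a x y t g` = anchor `a`, palette `(x,y)`, profiles `(g, −t·g)` (theory ruling
  (c1)(5): `P₁ = X_a(X_x − tX_y)²`) with the kernel identity
  `Re m = FormDetDD(a,x,x)(g) − 2t·FormDetDD(a,x,y)(g) + t²·FormDetDD(a,y,y)(g)` (`entangledMain_sosCell_re`,
  the numerics' «Q(t) by linearity») and its discriminant consequence under the member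
  (`formDetDD_sq_le_of_conePSD`: `FormDetDD(a,x,y)² ≤ FormDetDD(a,x,x)·FormDetDD(a,y,y)`); an explicit inhabitant
  `sosCellHalf23` (the scanned cell `(½; 2, 3; t = 1)` on the linear profile `1 − y`, `inClass_sosCellHalf23`).

0 named facts, 0 sorries; elementary throughout.

## References

* Y. Zhang, arXiv:2211.02515v1 (2022), §2 (2.13)–(2.18), Lemma 2.3 p.6, (2.32)–(2.33); §7 Prop 7.1, (7.2) p.44,
  (7.19)–(7.21). [cite: Zhang2022LandauSiegel, Prop 7.1 p.44]
* Cell documents (not literature): `B-det/KILL-draft.md` v1.8/v2.0 §1a, §2 (i′); `B-det/plan/D2PLUS-SPEC.md` v1.0.1;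
  §E RULING 2026-08-26T23:22:50Z (INTAKE-4, row S-E-bdet-1).
-/

noncomputable section

open Complex Real ComplexConjugate Set

namespace Literature.NumberTheory.LFunctions.Zhang2022

namespace Det

/-! ### The SOS cells of det-D2⁺ as rank-one entangled members: `Re m = F(a,x,x) − 2tF(a,x,y) + t²F(a,y,y)` -/

variable {g g' : ℝ → ℂ}

/-- The recipe form of an arbitrary triple is symmetric in the two palette entries:
`FormDetDD (a,y,x) = FormDetDD (a,x,y)`. [cite: Zhang2022LandauSiegel, proof of Prop 7.1, (7.19)–(7.21)] -/
theorem formDetDD_swap (a x y : ℝ) (g g' : ℝ → ℂ) : FormDetDD ![a, y, x] g g' = FormDetDD ![a, x, y] g g' := by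
  rw [FormDetDD, FormDetDD, ddM0_swap a x y, ddMs_swap a x y, ddMn_swap a x y, ddMb_swap a x y, ddMbs_swap a x y,
    ddMbn_swap a x y]

/-- The coefficient vector `(1, −t)` of the SOS cell `X_a(X_x − tX_y)²`. [cite: Zhang2022LandauSiegel, §2 (2.13), (2.15)] -/
def sosVec (t : ℝ) : Fin 2 → ℂ := ![1, -(t : ℂ)]

/-- **The SOS cell's main term (theory ruling (c1)(5); the numerics' `Q(t)` «by linearity»):** for anchor `a`,
palette `(x,y)` and profiles `(g, −t·g)`,
`Re m(a;(x,y);(g,−tg)) = FormDetDD(a,x,x)(g) − 2t·FormDetDD(a,x,y)(g) + t²·FormDetDD(a,y,y)(g)`.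
[cite: Zhang2022LandauSiegel, Prop 7.1 p.44, (7.19)–(7.21)] -/
theorem entangledMain_sosCell_re (a x y t : ℝ) (g g' : ℝ → ℂ) :
    (entangledMain a ![x, y] (fun j => sosVec t j • g) (fun j => sosVec t j • g')).re
      = FormDetDD ![a, x, x] g g' - 2 * t * FormDetDD ![a, x, y] g g' + t ^ 2 * FormDetDD ![a, y, y] g g' := by
  rw [entangledMain_rankOne]
  simp only [Fin.sum_univ_two, sosVec, Matrix.cons_val_zero, Matrix.cons_val_one,
    formDetDD_swap a x y, map_one, map_neg, Complex.conj_ofReal, Complex.add_re, Complex.mul_re, Complex.one_re,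
    Complex.one_im, Complex.neg_re, Complex.neg_im, Complex.ofReal_re, Complex.ofReal_im]
  ring

/-- **Discriminant consequence of the E-102 member on a pair palette:** if `BigF(a;(x,y)) ⪰ 0` on one-sided
kinked profiles then for every such profile `g`, `FormDetDD(a,x,y)(g)² ≤ FormDetDD(a,x,x)(g)·FormDetDD(a,y,y)(g)`
(the `2×2` matrix of diagonal recipe values on the slice `(g, −tg)` is PSD). [cite: Zhang2022LandauSiegel, Prop 7.1 p.44, (7.2), (7.19)–(7.21)] -/
theorem formDetDD_sq_le_of_conePSD {a x y : ℝ} (hP : ConePSD a ![x, y]) (hg : Repair.KinkedProfile g g')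
    (hg1 : g 1 = 0) :
    FormDetDD ![a, x, y] g g' ^ 2 ≤ FormDetDD ![a, x, x] g g' * FormDetDD ![a, y, y] g g' := by
  have hq : ∀ t : ℝ, 0 ≤ FormDetDD ![a, y, y] g g' * (t * t) + (-(2 * FormDetDD ![a, x, y] g g')) * t
      + FormDetDD ![a, x, x] g g' := by
    intro t
    have h := hP (fun j => sosVec t j • g) (fun j => sosVec t j • g') (fun j => ?_) (fun j => ?_)
    · rw [entangledMain_sosCell_re] at h
      linarith
    · fin_cases j
      · simpa [sosVec] using hg
      · exact ⟨hg.cont.const_smul _, fun z hz => (hg.hasDeriv z hz).const_smul _, hg.memLp.const_smul _⟩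
    · simp [sosVec, hg1]
  have hd := discrim_le_zero hq
  rw [discrim] at hd
  nlinarith [hd]

end Det

namespace Repair

open Det

/-! ### The family: designs, class predicate, verdict with the E-102 member displayed -/

/-- **An ENTANGLED detector of class DET as §E data** (widened clause (i′) of the B-det word): `K` palette shift
multiples `b`, an anchor shift multiple `a`, and the profile vector `h` (marked right derivatives `h′`) it is run
on — the detector `Σ_ρ (iM′)²α³·x_a·|Σ_j x_jA_{h_j}|²·ω`, `x_j = M(ρ+iαb_j)/(iαM′(ρ))`.
[cite: Zhang2022LandauSiegel, §2 (2.13), (2.15)–(2.16); §7 (7.2) p.44] -/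
structure DetEntangledDesign : Type where
  /-- the number of palette shifts -/
  K : ℕ
  /-- the anchor shift multiple `b_a` -/
  a : ℝ
  /-- the palette `b_1, …, b_K` -/
  b : Fin K → ℝ
  /-- the profile vector -/
  h : Fin K → ℝ → ℂ
  /-- its marked right derivatives -/
  h' : Fin K → ℝ → ℂ

namespace DetEntangledDesign

/-- **Class membership** (NO analytic hypothesis inside): anchor `a ∈ (0,1)` (anchor variable `x_a > 0` on every
Prop-2.2 configuration — no `ψ`-site below `a`), palette in the Part-III contour box `(0,5)`, every profile a
ONE-SIDED kinked profile vanishing at the top (`h_j(1) = 0`, the range (7.2) of Prop 7.1).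
[cite: Zhang2022LandauSiegel, §2 (2.13), Lemma 2.3 p.6; §7 Prop 7.1, (7.2) p.44] -/
def InClass (d : DetEntangledDesign) : Prop :=
  (0 < d.a ∧ d.a < 1) ∧ (∀ j, 0 < d.b j ∧ d.b j < 5) ∧ (∀ j, KinkedProfile (d.h j) (d.h' j)) ∧ ∀ j, d.h j 1 = 0

/-- **The verdict «no POS closing at main order», E-102 MEMBER displayed:** IF the block moment matrix of the
design's anchor and palette is PSD on one-sided kinked profiles (`Det.ConePSD d.a d.b`, bare `Prop`, kind (c),
registry E-102 member — NOT asserted), THEN the main-term constant of this pointwise non-negative detector is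
not negative: `¬ (Re m(a;b;h) < 0)`. [cite: Zhang2022LandauSiegel, §2 (2.16), (2.32); §7 Prop 7.1 p.44] -/
def Verdict (d : DetEntangledDesign) : Prop :=
  ConePSD d.a d.b → ¬ ((entangledMain d.a d.b d.h d.h').re < 0)

end DetEntangledDesign

/-- **NOT REPAIRABLE BY AN ENTANGLED CLASS-DET DETECTOR (block-form currency, E-102 member displayed).** For every
member — any anchor in `(0,1)`, any finite palette in `(0,5)`, any one-sided kinked profile vector — the member
`ConePSD a b` gives `0 ≤ Re m(a;b;h)`, so the POS endgame's closing condition `Re m < 0` fails. A statement about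
the method's main terms; nothing about zeros. [cite: Zhang2022LandauSiegel, §2 (2.16), (2.32); §7 Prop 7.1 p.44] -/
theorem not_repairable_detEntangled : ∀ d : DetEntangledDesign, d.InClass → d.Verdict :=
  fun d h hP => not_lt.mpr (hP d.h d.h' h.2.2.1 h.2.2.2)

/-- the inequality itself on the class, under the member: `0 ≤ Re m(a;b;h)`.
[cite: Zhang2022LandauSiegel, §2 (2.16), (2.32)] -/
theorem detEntangled_nonneg (d : DetEntangledDesign) (h : d.InClass) (hP : ConePSD d.a d.b) :
    0 ≤ (entangledMain d.a d.b d.h d.h').re :=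
  hP d.h d.h' h.2.2.1 h.2.2.2

/-- **GIVEN THE ROW E-102** (`Det.EdetCone (Set.Ioo 0 1) (Set.Ioo 0 5)`, det-E15 on the continuum) every member's
slot is discharged: `0 ≤ Re m` on the whole class. [cite: Zhang2022LandauSiegel, §2 (2.16), (2.32); §7 (7.2) p.44] -/
theorem detEntangled_nonneg_of_edetCone (hE : EdetCone (Set.Ioo 0 1) (Set.Ioo 0 5)) (d : DetEntangledDesign)
    (h : d.InClass) : 0 ≤ (entangledMain d.a d.b d.h d.h').re :=
  detEntangled_nonneg d h (hE.conePSD (K := d.K) h.1 fun j => h.2.1 j)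

/-- … hence the verdict's conclusion unconditionally in the row: `¬ (Re m < 0)` for every member, GIVEN E-102.
[cite: Zhang2022LandauSiegel, §2 (2.16), (2.32)] -/
theorem detEntangled_verdict_of_edetCone (hE : EdetCone (Set.Ioo 0 1) (Set.Ioo 0 5)) (d : DetEntangledDesign)
    (h : d.InClass) : ¬ ((entangledMain d.a d.b d.h d.h').re < 0) :=
  not_lt.mpr (detEntangled_nonneg_of_edetCone hE d h)

/-! ### Extension protocol of `RepairRplus` -/

/-- family «entangled class-DET detector, one-sided profiles, block-form currency» (E-102 member `Det.ConePSD`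
displayed in the verdict, nothing conditional in the class). [cite: Zhang2022LandauSiegel, §2 (2.16), (2.32)–(2.33)] -/
def familyDetEntangled : DesignFamily where
  Design := DetEntangledDesign
  InClass := DetEntangledDesign.InClass
  Verdict := DetEntangledDesign.Verdict

/-- `familyDetEntangled` is decided. [cite: Zhang2022LandauSiegel, §2 (2.32)–(2.33)] -/
theorem familyDetEntangled_decided : familyDetEntangled.Decided := not_repairable_detEntangled

/-- **`R⁺ ++ [familyDetEntangled]` is decided** (`RepairRplus.rplus_extend`). [cite: Zhang2022LandauSiegel, §2 (2.32)–(2.33)] -/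
theorem rplus_detEntangled_decided : ClassDecided (Rplus ++ [familyDetEntangled]) :=
  rplus_extend familyDetEntangled_decided

/-! ### C2: the `K = 1` members are the repeated-shift monomials `X_a·X_x²` -/

/-- For a single-shift palette `(x)` the verdict reads through the recipe form of the repeated triple:
GIVEN «`FormDetDD (a,x,x) ≥ 0` on one-sided kinked profiles» (which IS the member, `Det.conePSD_fin_one_iff`),
`¬ (FormDetDD (a,x,x)(h₀) < 0)`. [cite: Zhang2022LandauSiegel, Prop 7.1 p.44, (7.2), (7.19)–(7.21)] -/
theorem detEntangled_verdict_fin_one {a x : ℝ} {h h' : Fin 1 → ℝ → ℂ}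
    (hcls : DetEntangledDesign.InClass ⟨1, a, ![x], h, h'⟩)
    (hF : ∀ g g' : ℝ → ℂ, KinkedProfile g g' → g 1 = 0 → 0 ≤ FormDetDD ![a, x, x] g g') :
    ¬ (FormDetDD ![a, x, x] (h 0) (h' 0) < 0) := by
  have hv := not_repairable_detEntangled ⟨1, a, ![x], h, h'⟩ hcls ((conePSD_fin_one_iff a x).2 hF)
  simpa [DetEntangledDesign.Verdict, entangledMain_fin_one_re] using hv

/-! ### C4: members by term — the det-D2⁺ SOS cells -/

/-- **The SOS cell `X_a(X_x − tX_y)²` on a profile `g`** as an entangled member: anchor `a`, palette `(x,y)`,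
profiles `(g, −t·g)`. [cite: Zhang2022LandauSiegel, §2 (2.13), (2.15)] -/
def sosCell (a x y t : ℝ) (g g' : ℝ → ℂ) : DetEntangledDesign :=
  ⟨2, a, ![x, y], fun j => sosVec t j • g, fun j => sosVec t j • g'⟩

/-- Membership of an SOS cell: `a ∈ (0,1)`, `x, y ∈ (0,5)`, `g` one-sided kinked.
[cite: Zhang2022LandauSiegel, §2 (2.13), Lemma 2.3 p.6; §7 (7.2) p.44] -/
theorem inClass_sosCell {a x y t : ℝ} {g g' : ℝ → ℂ} (ha : 0 < a ∧ a < 1) (hx : 0 < x ∧ x < 5)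
    (hy : 0 < y ∧ y < 5) (hg : KinkedProfile g g') (hg1 : g 1 = 0) : (sosCell a x y t g g').InClass := by
  refine ⟨ha, fun j => ?_, fun j => ?_, fun j => ?_⟩
  · fin_cases j
    · simpa [sosCell] using hx
    · simpa [sosCell] using hy
  · exact ⟨hg.cont.const_smul _, fun z hz => (hg.hasDeriv z hz).const_smul _, hg.memLp.const_smul _⟩
  · simp [sosCell, hg1]

/-- The SOS cell's main term in recipe values (`Det.entangledMain_sosCell_re`).
[cite: Zhang2022LandauSiegel, Prop 7.1 p.44, (7.19)–(7.21)] -/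
theorem mainTerm_sosCell_re (a x y t : ℝ) (g g' : ℝ → ℂ) :
    (entangledMain (sosCell a x y t g g').a (sosCell a x y t g g').b (sosCell a x y t g g').h
        (sosCell a x y t g g').h').re
      = FormDetDD ![a, x, x] g g' - 2 * t * FormDetDD ![a, x, y] g g' + t ^ 2 * FormDetDD ![a, y, y] g g' :=
  entangledMain_sosCell_re a x y t g g'

/-- The SOS cell's verdict spelled out: GIVEN the pair member `ConePSD a (x,y)`,
`¬ (FormDetDD(a,x,x)(g) − 2t·FormDetDD(a,x,y)(g) + t²·FormDetDD(a,y,y)(g) < 0)`.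
[cite: Zhang2022LandauSiegel, §2 (2.16), (2.32); Prop 7.1 p.44] -/
theorem verdict_sosCell {a x y t : ℝ} {g g' : ℝ → ℂ} (hcls : (sosCell a x y t g g').InClass)
    (hP : ConePSD a ![x, y]) :
    ¬ (FormDetDD ![a, x, x] g g' - 2 * t * FormDetDD ![a, x, y] g g' + t ^ 2 * FormDetDD ![a, y, y] g g' < 0) := by
  rw [← mainTerm_sosCell_re]
  exact not_repairable_detEntangled _ hcls hP

/-- The linear one-sided profile `g(y) = 1 − y`. [cite: Zhang2022LandauSiegel, §7 (7.2) p.44] -/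
def linProfile : ℝ → ℂ := fun y => ((1 - y : ℝ) : ℂ)

/-- Its derivative `−1`. [cite: Zhang2022LandauSiegel, §7 (7.2) p.44] -/
def linProfile' : ℝ → ℂ := fun _ => -1

/-- `1 − y` is a one-sided kinked profile. [cite: Zhang2022LandauSiegel, §7 Prop 7.1, (7.2) p.44] -/
theorem kinkedProfile_lin : KinkedProfile linProfile linProfile' where
  cont := (Complex.continuous_ofReal.comp (continuous_const.sub continuous_id)).continuousOn
  hasDeriv := fun x _ => by
    have h : HasDerivAt linProfile (-1) x := by
      have h1 : HasDerivAt (fun y : ℝ => ((y : ℝ) : ℂ)) 1 x := Complex.ofRealCLM.hasDerivAt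
      have h2 := (hasDerivAt_const x (1 : ℂ)).sub h1
      simp only [zero_sub] at h2
      refine h2.congr_of_eventuallyEq (Filter.Eventually.of_forall fun y => ?_)
      simp [linProfile]
    exact h.hasDerivWithinAt
  memLp := MeasureTheory.memLp_const (-1 : ℂ)

/-- `(1 − y)|_{y=1} = 0`. [cite: Zhang2022LandauSiegel, §7 (7.2) p.44] -/
theorem linProfile_one : linProfile 1 = 0 := by
  simp [linProfile]

/-- **An explicit member: the scanned det-D2⁺ cell `(½; 2, 3; t = 1)`** — `P₁ = X_{1/2}(X_2 − X_3)²` — on the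
linear profile. [cite: Zhang2022LandauSiegel, §2 (2.13), (2.15); §7 (7.2) p.44] -/
def sosCellHalf23 : DetEntangledDesign := sosCell (1 / 2) 2 3 1 linProfile linProfile'

/-- `sosCellHalf23` is a member of the family (C4: the class is inhabited by a scanned design).
[cite: Zhang2022LandauSiegel, §2 (2.13), Lemma 2.3 p.6; §7 (7.2) p.44] -/
theorem inClass_sosCellHalf23 : sosCellHalf23.InClass :=
  inClass_sosCell (by norm_num) (by norm_num) (by norm_num) kinkedProfile_lin linProfile_one

/-- … and carries the family verdict (slot `ConePSD (1/2) (2,3)` displayed, asserted nowhere).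
[cite: Zhang2022LandauSiegel, §2 (2.16), (2.32)–(2.33)] -/
theorem verdict_sosCellHalf23 : sosCellHalf23.Verdict :=
  not_repairable_detEntangled _ inClass_sosCellHalf23

end Repair

end Literature.NumberTheory.LFunctions.Zhang2022
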